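import Summits.BirchSwinnertonDyer.Rank1Residual.Additive.KatoDescentKMCImpReadingIstarKForm
import Summits.BirchSwinnertonDyer.BirchSwinnertonDyer.Theorems.SchneiderFreeAdditiveX3PoitouTateReciprocitySumHolds
import HarnessLib

set_option autoImplicit false

/-!
# Crux 19223 `CccOneLawOnTypeIstarZero` BY NAME from the Kato–Perrin-Riou line on the K8 route of record WITH POITOU–TATE DISCHARGED:
# `poitouTate_selmerStructure_duality_real ℚ` is a THEOREM of the tree (cell `bsd-schneider`,
# `SchneiderFreeAdditiveX3.PoitouTateReduction.poitouTate_selmerStructure_duality_real_holds`, p626891; route item 19417 `PoitouTateRealRat`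
# CLOSED by it, p628462), so Part 58's binder `hPT` LEAVES THE K8 KPR CONE — the composition head for the v10 `kato_perrin_riou_istar`
# skeleton (seat `bsd-cm-prr-ty1` g21, cell `bsd-cm`; theorems only: no definition, no named fact, no instance, no `sorry`; this file
# registers nothing — the planner touches the skeleton)

Part 59 of the seat's kernel cut (crux stmt-BirchSwinnertonDyer-19223).  LEAF AUDIT of Part 58 ★★★
`cccOneLawOnTypeIstarZero_of_rowCountOfGZK_of_rowRealizableOfGZK_of_kmcFineContra_of_perrinRiouRatio_of_plusMCEtaK (hCrows) (hrealRows) (hKMC)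
(hPR) (hK : PlusMCEtaK) (hR : SignedReadingFacts) (hnf) (hGZK) (hPT)`: of its five named inputs, `hPT :
Literature.NumberTheory.GaloisCohomology.poitouTate_selmerStructure_duality_real ℚ` (Poitou–Tate duality for Selmer structures over `ℚ` with
the real place; Milne *ADT* I Thm. 4.10 (b), Howard 2004 Thm. 2.1.11) is the ONLY one with a discharge in the tree — for every number field
`K`, unconditionally (`…poitouTate_selmerStructure_duality_real_holds K`; the K8 route records it as the closed child 19417 and the slimmed
pack `publishedFactsInert_of_slim_real`, but the registered KPR skeleton never read it).  `exists_isNewformOf`, GZK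
`rank_eq_analyticRank_of_analyticRank_le_one`, Kitajima–Otsuki 1.3 / Kobayashi 7.4 (`SignedReadingFacts`), H2X′, F-CM, BT26 have NO `_holds`
(checked 2026-08-29) and stay named inputs; `PlusMCEtaK` (19501) stays the route's open crux.
HEAD.  ★★★★ `cccOneLawOnTypeIstarZero_of_rowCountOfGZK_of_rowRealizableOfGZK_of_kmcFineContra_of_perrinRiouRatio_of_plusMCEtaK_real (hCrows)
(hrealRows) (hKMC) (hPR) (hK : PlusMCEtaK) (hR : SignedReadingFacts) (hnf : exists_isNewformOf) (hGZK)` := Part 58 ★★★ at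
`hPT := poitouTate_selmerStructure_duality_real_holds ℚ`; every other binder BYTE-IDENTICAL to Part 58's / Part 55's.  v10 (planner's
touch): `stub_printInputsInert : SignedReadingFacts ∧ rank_eq_analyticRank_of_analyticRank_le_one`; composition `:= <★★★★> rowCount_closed
realizable_closed (kmcFine_closed ·) (stub_perrinRiouRatioIstarZero ·) stub_plusMCEtaK stub_printInputsInert.1 stub_printFactsKato.2.1
stub_printInputsInert.2`.
READING OF RECORD it yields (19223 via the KPR line): RESEARCH {PR^× on the rows, μ-equality at (p)} ∪ ROUTE CRUX {`PlusMCEtaK` 19501 (open part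
= its μ-part 19865)} ∪ PRINT named facts {H2X′, `exists_isNewformOf`, F-CM, BT26 Thm. 2.6, Kitajima–Otsuki 1.3, Kobayashi 7.4, GZK} — Poitou–Tate is
a THEOREM, no longer an input.
HONEST LABEL: CONDITIONAL on the displayed hypotheses; the crux is concluded BY NAME, never restated; 19223 and 19501 stay OPEN; no stub is
closed on the ledger; X12.CMInertBad is NOT proved; no summit statement is proved by this seat; BSD is not proved for any curve.
[cite: MilneADT2006, Ch. I, Thm. 4.10 (b), Cor. 2.3, Thm. 2.6] [cite: Howard2004HeegnerKolyvagin, Thm. 2.1.11 (arXiv:1202.6340 p. 6)]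
[cite: Kobayashi2003, §4 (p. 8), Thm. 7.4 (p. 13)] [cite: KitajimaOtsuki2018, Main Thm. 1.3 (arXiv:1607.03612 p. 3)]
[cite: BurnsKuriharaSano2019, Thm. 7.6 (p. 29), Conj. 2.8 (ii) (p. 10)] [cite: Kato2004Asterisque, Conj. 12.10 (p. 224), §14.14 (p. 243)]
-/

noncomputable section

open scoped Classical NumberField

open WeierstrassCurve Literature.NumberTheory.EllipticCurves
  Literature.NumberTheory.EllipticCurves.ModularForms
  Literature.NumberTheory.EllipticCurves.Rank1Residual
  Literature.NumberTheory.EllipticCurves.Rank1Residual.Typed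
  Literature.NumberTheory.EllipticCurves.IwasawaAlgebra
  Literature.NumberTheory.GaloisCohomology
open Summit.BirchSwinnertonDyer.Rank1Residual
open Summit.BirchSwinnertonDyer.Rank1Residual.Additive
open Summit.BirchSwinnertonDyer.Rank1Residual.X12.O10
open Summit.BirchSwinnertonDyer.BirchSwinnertonDyer.Theses.InertBadSignedBranches
open Summit.BirchSwinnertonDyer.BirchSwinnertonDyer.Theorems

namespace Summit.BirchSwinnertonDyer.Rank1Residual.Additive.KMCImpReadingPointwise

/-- ★★★★ **Crux 19223 BY NAME from a ROW-KEYED stub 3 and a ROW-KEYED stub 4, both GUARDED BY GZK, on the route's rev-4 items, with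
Poitou–Tate DISCHARGED** — Part 58 ★★★
`cccOneLawOnTypeIstarZero_of_rowCountOfGZK_of_rowRealizableOfGZK_of_kmcFineContra_of_perrinRiouRatio_of_plusMCEtaK` at
`hPT := SchneiderFreeAdditiveX3.PoitouTateReduction.poitouTate_selmerStructure_duality_real_holds ℚ` (cell `bsd-schneider`, p626891:
Poitou–Tate duality for Selmer structures with the real places, every number field, unconditional); `hCrows`, `hrealRows`, `hKMC`, `hPR`
BYTE-IDENTICAL to Part 55's (= the registered `rowCount_closed` / `realizable_closed` / `kmcFine_closed` / `stub_perrinRiouRatioIstarZero`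
types), `hK : PlusMCEtaK` (route crux 19501), `hR : SignedReadingFacts` (route item 19502), `hnf`, `hGZK` named facts.  Intended as the
composition term of a v10 istar skeleton whose stub 6b reads `SignedReadingFacts ∧ rank_eq_analyticRank_of_analyticRank_le_one` (this
file registers nothing).  CONDITIONAL; 19223 / 19501 stay OPEN; BSD is not proved.
[cite: MilneADT2006, Ch. I, Thm. 4.10 (b)] [cite: Howard2004HeegnerKolyvagin, Thm. 2.1.11 (arXiv:1202.6340 p. 6)]
[cite: Kobayashi2003, §4 (p. 8), Thm. 7.4 (p. 13)] [cite: BurnsKuriharaSano2019, Thm. 7.6 (p. 29), Conj. 2.8 (ii) (p. 10)] -/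
theorem cccOneLawOnTypeIstarZero_of_rowCountOfGZK_of_rowRealizableOfGZK_of_kmcFineContra_of_perrinRiouRatio_of_plusMCEtaK_real
    (hCrows : rank_eq_analyticRank_of_analyticRank_le_one →
      ∀ (p : ℕ) [Fact p.Prime], 5 ≤ p → ∀ (W : WeierstrassCurve ℚ) [W.IsElliptic] [W.IsGloballyMinimal],
      HasSignedLocalType W p (.Istar 0) → W.analyticRank = 1 →
      ∀ (D : KatoDescentDatum p) (ℒ : ℚ_[p]),
        IsKatoZetaDescentDatumOfContra W p D → Kato2004.PRRatio W p ℒ →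
        Finite (coinvariants p D.H2) ∧ (ℒ ≠ 0 ↔ D.zetaIndex ≠ 0) ∧
          ∀ m : ℕ, D.zetaIndex = p ^ m * D.h2Card →
            ℒ.valuation = (m : ℤ) +
              padicValNat p (Nat.card (AddCommGroup.primaryComponent W.sha p)) +
              padicValNat p W.tamagawaProduct)
    (hrealRows : rank_eq_analyticRank_of_analyticRank_le_one →
      ∀ (p : ℕ) [Fact p.Prime], 5 ≤ p → ∀ (W : WeierstrassCurve ℚ) [W.IsElliptic] [W.IsGloballyMinimal],
      HasSignedLocalType W p (.Istar 0) → W.analyticRank = 1 →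
      KatoMainConjectureFineContra W p → ∃ D : KatoDescentDatum p, IsKatoZetaDescentDatumOfContra W p D)
    (hKMC : ∀ (p : ℕ) [Fact p.Prime], 5 ≤ p → ∀ (W : WeierstrassCurve ℚ) [W.IsElliptic]
      [W.IsGloballyMinimal], HasSignedLocalType W p (.Istar 0) → W.analyticRank = 1 →
      KatoMainConjectureFineContra W p)
    (hPR : ∀ (p : ℕ) [Fact p.Prime], 5 ≤ p → ∀ (W : WeierstrassCurve ℚ) [W.IsElliptic]
      [W.IsGloballyMinimal], HasSignedLocalType W p (.Istar 0) → W.analyticRank = 1 →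
      PerrinRiouUpToUnitAt Kato2004.PRRatio W p)
    (hK : PlusMCEtaK) (hR : SignedReadingFacts) (hnf : exists_isNewformOf)
    (hGZK : rank_eq_analyticRank_of_analyticRank_le_one) :
    CccOneLawOnTypeIstarZero :=
  cccOneLawOnTypeIstarZero_of_rowCountOfGZK_of_rowRealizableOfGZK_of_kmcFineContra_of_perrinRiouRatio_of_plusMCEtaK hCrows hrealRows
    hKMC hPR hK hR hnf hGZK (SchneiderFreeAdditiveX3.PoitouTateReduction.poitouTate_selmerStructure_duality_real_holds ℚ)

end Summit.BirchSwinnertonDyer.Rank1Residual.Additive.KMCImpReadingPointwise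

end
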